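import Summits.KontsevichZagierPeriods.KontsevichZagierPeriods.Theorems.SoloBlindFermatCubic
import Summits.KontsevichZagierPeriods.KontsevichZagierPeriods.Theorems.SoloBlindBoxRankOne
import HarnessLib

/-!
# The silver region: `∫∫_{0<x<1, 0≤y, y²(1+x²)≤1} dx dy = log (1 + √2)` inside the rules

A bounded planar region with a `ℚ`-polynomial boundary whose area is the logarithm of a UNIT
of a real quadratic field — the regulator `log (1 + √2)` of `ℚ(√2)`:

  `Σ = {(x,y) | 0 < x < 1, 0 ≤ y, y²(1 + x²) ≤ 1}`,  `area(Σ) = ∫₀¹ dx/√(1+x²) = arsinh 1`.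

Its class in `Q` is computed by KZ moves only: ONE Newton–Leibniz move to the line
(`hyp2_sub_hyp1`), ONE rational chart `x = (u² - 1)/(2u) = sinh log u` carrying
`[(0,1), (1+x²)^{-1/2}]` to `[(1, 1+√2), du/u]` (`openLog_sub_hyp1`), ONE domain-additivity move
discarding the two endpoints (`logCell_sub_openLog`).  Hence
**`[Σ] = ℓ(1+√2)`** (`mkQ_hyp2`), `Σ` lies in the cell span `V` (`mkQ_hyp2_mem_cellSpan`), and by
the Baker injectivity of `evalQ` on `V` (`eq_zero_of_mem_cellSpan`) the Kontsevich–Zagier conjecture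
holds for `Σ` against every representation with class in `V` (`kz_hyp2`; the general form is
`kz_cellSpan`).  Read off: `area(Σ) = log (1+√2)` (`hyp2_value`), `Σ ≡ L(1; 1+√2)` and
`Σ ≡ L(½; 3+2√2)` (`kz_hyp2_logCell`, `kz_hyp2_logCell_sq`).

References: Kontsevich–Zagier, *Periods* (2001), §1.1–1.2; Baker (1975), Ch. 2.
-/

noncomputable section

namespace Summit.KontsevichZagierPeriods.KontsevichZagierPeriods.Theorems

open Set MeasureTheory
open Literature.ModelTheory.ExponentialFields (IsSemialgebraic)
open MvPolynomial (aeval X C)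
open Literature.NumberTheory.Transcendental
open Literature.NumberTheory.Transcendental.KZ

namespace SoloBlind

/-! ## The silver ratio -/

/-- The silver ratio `σ = 1 + √2` (the fundamental unit of `ℤ[√2]`). -/
def silver : ℝ := 1 + Real.sqrt 2

/-- `1 < σ`. -/
theorem one_lt_silver : 1 < silver := by
  have h : 0 < Real.sqrt 2 := Real.sqrt_pos.mpr two_pos
  unfold silver
  linarith

/-- `0 < σ`. -/
theorem silver_pos : 0 < silver := one_pos.trans one_lt_silver

/-- `σ² = 2σ + 1` (`= 3 + 2√2`). -/
theorem silver_sq' : silver ^ 2 = 2 * silver + 1 := by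
  have h := Real.sq_sqrt (zero_le_two (α := ℝ))
  unfold silver
  nlinarith [h]

/-- `σ` is algebraic (a root of `X² - 2X - 1`). -/
theorem isAlgebraic_silver : IsAlgebraic ℚ silver := by
  refine ⟨Polynomial.X ^ 2 - 2 * Polynomial.X - 1, fun h => ?_, ?_⟩
  · have h0 := congrArg (Polynomial.eval 0) h
    norm_num at h0
  · simp only [map_sub, map_mul, map_pow, Polynomial.aeval_X, map_one]
    rw [silver_sq', show (Polynomial.aeval silver) (2 : Polynomial ℚ) = (2:ℝ) from map_ofNat _ 2]
    ring

/-! ## The integrand `h(x) = (1+x²)^{-1/2}` and `H₁ = [(0,1), h]` -/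

/-- `h(x) = (1 + x²)^{-1/2}`. -/
def hypF (x : ℝ) : ℝ := (1 + x ^ 2) ^ ((((-1:ℚ) / 2 : ℚ) : ℝ))

/-- `h(x) = 1/√(1+x²)`. -/
theorem hypF_eq (x : ℝ) : hypF x = 1 / Real.sqrt (1 + x ^ 2) := by
  have hq : (0:ℝ) ≤ 1 + x ^ 2 := by positivity
  rw [hypF, Real.sqrt_eq_rpow, one_div, ← Real.rpow_neg hq]
  norm_num

/-- `0 < h(x)`. -/
theorem hypF_pos (x : ℝ) : 0 < hypF x := Real.rpow_pos_of_pos (by positivity) _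

/-- `h(x) ≤ 1`. -/
theorem hypF_le_one (x : ℝ) : hypF x ≤ 1 :=
  Real.rpow_le_one_of_one_le_of_nonpos (by nlinarith [sq_nonneg x]) (by norm_num)

/-- `h` is continuous. -/
theorem continuous_hypF : Continuous hypF :=
  (continuous_const.add (continuous_pow 2)).rpow_const fun x =>
    Or.inl (by positivity : (0:ℝ) < 1 + x ^ 2).ne'

/-- `h` is integrable on `(0,1)`. -/
theorem integrableOn_hypF : IntegrableOn hypF (Ioo 0 1) :=
  (continuous_hypF.continuousOn.integrableOn_Icc (μ := volume)).mono_set Ioo_subset_Icc_self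

/-- `h` is `ℚ`-semialgebraic on `(0,1)` (an Euler–Mellin integrand). -/
theorem isSemialgebraicFunOn_hypF :
    IsSemialgebraicFunOn ℚ (line (Ioo 0 1)) (fun x : Fin 1 → ℝ => hypF (x 0)) := by
  have h := isSemialgebraicFunOn_mellinIntegrand
    (isSemialgebraic_line_Ioo isAlgebraic_zero isAlgebraic_one)
    ![(1 + X 0 ^ 2 : MvPolynomial (Fin 1) ℚ)] ![((-1:ℚ) / 2 : ℚ)] 1 (fun x _ k => by
      have hx : (0:ℝ) < 1 + x 0 ^ 2 := by positivity
      simpa using hx)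
  refine h.congr fun x _ => ?_
  simp only [mellinIntegrand_apply, Fin.prod_univ_one, Matrix.cons_val_fin_one, map_add, map_one,
    map_pow, MvPolynomial.aeval_X, hypF]
  push_cast
  ring_nf

/-- **`H₁ = [(0,1), (1+x²)^{-1/2}]`** (value `arsinh 1 = log (1+√2)`). -/
def hyp1 : IntegralRep 1 :=
  lineRep (Ioo 0 1) hypF (isSemialgebraic_line_Ioo isAlgebraic_zero isAlgebraic_one)
    isSemialgebraicFunOn_hypF integrableOn_hypF

/-! ## The silver region `Σ` -/

/-- The silver region `Σ = {0 < x < 1, 0 ≤ y, y²(1+x²) ≤ 1}`. -/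
def kzSilver : Set (Fin 2 → ℝ) :=
  {z | (0 < z 0 ∧ z 0 < 1) ∧ 0 ≤ z 1 ∧ z 1 ^ 2 * (1 + z 0 ^ 2) ≤ 1}

/-- Membership in `kzSilver`, unfolded. -/
theorem mem_kzSilver {z : Fin 2 → ℝ} :
    z ∈ kzSilver ↔ (0 < z 0 ∧ z 0 < 1) ∧ 0 ≤ z 1 ∧ z 1 ^ 2 * (1 + z 0 ^ 2) ≤ 1 := Iff.rfl

/-- `kzSilver` is `ℚ`-semialgebraic. -/
theorem isSemialgebraic_kzSilver : IsSemialgebraic ℚ kzSilver := by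
  convert isSemialgebraic_subgraph (X 1 ^ 2 * (1 + X 0 ^ 2)) 1 using 1
  ext z
  simp [kzSilver]

/-- `kzSilver` is the region under the graph of `h`. -/
theorem kzSilver_eq : kzSilver = {z | (0 < z 0 ∧ z 0 < 1) ∧ 0 ≤ z 1 ∧ z 1 ≤ hypF (z 0)} := by
  ext z
  simp only [mem_kzSilver, mem_setOf_eq]
  refine and_congr_right fun _ => and_congr_right fun hy => ?_
  have hq : (0:ℝ) < 1 + z 0 ^ 2 := by positivity
  rw [hypF_eq, one_div, ← Real.sqrt_inv, Real.le_sqrt hy, ← one_div, le_div_iff₀ hq]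
  exact inv_nonneg.mpr hq.le

/-- `kzSilver` lies in the unit square. -/
theorem kzSilver_subset : kzSilver ⊆ Icc 0 1 := subset_Icc_of_le_one fun z hz => by
  obtain ⟨hx, hy, h⟩ := hz
  refine ⟨hx, hy, ?_⟩
  nlinarith [mul_nonneg (sq_nonneg (z 1)) (sq_nonneg (z 0))]

/-- **`Σ = [{0<x<1, 0≤y, y²(1+x²)≤1}, 1]`**, with `ℚ`-rational data. -/
def hyp2 : IntegralRep 2 :=
  ratRep kzSilver (fun _ => 1) 1 1 isSemialgebraic_kzSilver (fun _ _ => by simp)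
    (fun _ _ => by simp) (integrableOn_one_of_subset_Icc kzSilver_subset)

/-- `Σ` has KZ's literal rational shape. -/
theorem isRational_hyp2 : hyp2.IsRational := isRational_ratRep

/-- **Move (Newton–Leibniz): `Σ ≡ H₁`.** -/
theorem hyp2_sub_hyp1 : of hyp2 - of hyp1 ∈ relations :=
  subgraph_sub_lineRep hyp2 (fun x _ => (hypF_pos x).le) kzSilver_eq rfl

/-! ## The chart `x = (u² - 1)/(2u)` from `(1, σ)` onto `(0, 1)` -/

/-- The chart `φ(u) = (u² - 1)/(2u) = sinh (log u)`. -/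
def sinhChart (u : ℝ) : ℝ := (u ^ 2 - 1) / (2 * u)

/-- Its derivative, in the raw form produced by the quotient rule. -/
def sinhChart' (u : ℝ) : ℝ := (2 * u * (2 * u) - (u ^ 2 - 1) * 2) / (2 * u) ^ 2

/-- `φ'(u) = (u²+1)/(2u²)`. -/
theorem sinhChart'_eq {u : ℝ} (hu : 0 < u) : sinhChart' u = (u ^ 2 + 1) / (2 * u ^ 2) := by
  unfold sinhChart'
  field_simp
  ring

/-- `|φ'(u)| = (u²+1)/(2u²)`. -/
theorem abs_sinhChart' {u : ℝ} (hu : 0 < u) : |sinhChart' u| = (u ^ 2 + 1) / (2 * u ^ 2) := by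
  rw [sinhChart'_eq hu]
  exact abs_of_pos (by positivity)

/-- The quotient rule for `φ`. -/
theorem hasDerivAt_sinhChart {u : ℝ} (hu : 0 < u) : HasDerivAt sinhChart (sinhChart' u) u := by
  have h1 : HasDerivAt (fun y : ℝ => y ^ 2 - 1) (2 * u) u := by
    simpa using (hasDerivAt_pow 2 u).sub_const 1
  have h2 : HasDerivAt (fun y : ℝ => 2 * y) 2 u := by
    simpa using (hasDerivAt_id u).const_mul 2
  exact h1.div h2 (by positivity)

/-- `φ` is `ℚ`-semialgebraic on `(1, σ)` (a rational function). -/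
theorem isSemialgebraicFunOn_sinhChart :
    IsSemialgebraicFunOn ℚ (line (Ioo 1 silver)) (fun x : Fin 1 → ℝ => sinhChart (x 0)) := by
  have hS := isSemialgebraic_line_Ioo isAlgebraic_one isAlgebraic_silver
  refine (isSemialgebraicFunOn_aeval_div_aeval hS (X 0 ^ 2 - 1) (2 * X 0) fun x hx => ?_).congr
    fun x _ => ?_
  · have hx : 1 < x 0 := hx.1
    have h : aeval x (2 * X 0 : MvPolynomial (Fin 1) ℚ) = 2 * x 0 := by simp
    rw [h]
    positivity
  · simp [sinhChart]

/-- `φ` is strictly increasing on `(0, ∞)`. -/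
theorem strictMonoOn_sinhChart : StrictMonoOn sinhChart (Ioi 0) := by
  intro s hs t ht hst
  have hs0 : (0:ℝ) < s := hs
  have ht0 : (0:ℝ) < t := ht
  unfold sinhChart
  rw [div_lt_div_iff₀ (by positivity) (by positivity)]
  nlinarith [mul_pos (mul_pos hs0 ht0) (sub_pos.mpr hst), sub_pos.mpr hst]

/-- `φ` is injective on `(1, σ)`. -/
theorem injOn_sinhChart : InjOn sinhChart (Ioo 1 silver) :=
  (strictMonoOn_sinhChart.mono fun _ hu => one_pos.trans hu.1).injOn

/-- `φ(1) = 0`. -/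
theorem sinhChart_one : sinhChart 1 = 0 := by simp [sinhChart]

/-- `φ(σ) = 1`. -/
theorem sinhChart_silver : sinhChart silver = 1 := by
  rw [sinhChart, silver_sq', div_eq_one_iff_eq (by linarith [silver_pos])]
  ring

/-- The inverse chart `u = y + √(y²+1)` lands in `(1, σ)` for `y ∈ (0,1)`. -/
theorem invChart_mem {y : ℝ} (hy : y ∈ Ioo (0:ℝ) 1) : y + Real.sqrt (y ^ 2 + 1) ∈ Ioo 1 silver := by
  have h1 : 1 < Real.sqrt (y ^ 2 + 1) := by
    have h := Real.sqrt_lt_sqrt zero_le_one (show (1:ℝ) < y ^ 2 + 1 by nlinarith [hy.1])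
    rwa [Real.sqrt_one] at h
  have h2 : Real.sqrt (y ^ 2 + 1) < Real.sqrt 2 :=
    Real.sqrt_lt_sqrt (by positivity) (by nlinarith [hy.1, hy.2])
  constructor
  · linarith [hy.1]
  · unfold silver
    linarith [hy.2]

/-- `φ(y + √(y²+1)) = y`. -/
theorem sinhChart_invChart {y : ℝ} (hy : 0 < y) : sinhChart (y + Real.sqrt (y ^ 2 + 1)) = y := by
  have hs := Real.sq_sqrt (by positivity : (0:ℝ) ≤ y ^ 2 + 1)
  have hpos : 0 < y + Real.sqrt (y ^ 2 + 1) := by positivity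
  rw [sinhChart, div_eq_iff (by positivity)]
  nlinarith [hs]

/-- `φ` maps `(1, σ)` onto `(0, 1)`. -/
theorem image_sinhChart : Ioo (0:ℝ) 1 = sinhChart '' Ioo 1 silver := by
  ext y
  constructor
  · intro hy
    exact ⟨_, invChart_mem hy, sinhChart_invChart hy.1⟩
  · rintro ⟨u, hu, rfl⟩
    have hm := strictMonoOn_sinhChart
    have hu0 : u ∈ Ioi (0:ℝ) := mem_Ioi.mpr (one_pos.trans hu.1)
    refine ⟨?_, ?_⟩
    · rw [← sinhChart_one]
      exact hm (show (1:ℝ) ∈ Ioi 0 from mem_Ioi.mpr one_pos) hu0 hu.1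
    · rw [← sinhChart_silver]
      exact hm hu0 (show silver ∈ Ioi 0 from mem_Ioi.mpr silver_pos) hu.2

/-- Pull-back of `h`: `h(φ(u))·|φ'(u)| = 1/u`. -/
theorem sinhChart_pullback {u : ℝ} (hu : 0 < u) :
    1 / u = hypF (sinhChart u) * |sinhChart' u| := by
  have hq : 1 + sinhChart u ^ 2 = ((u ^ 2 + 1) / (2 * u)) ^ 2 := by
    unfold sinhChart
    field_simp
    ring
  rw [abs_sinhChart' hu, hypF_eq, hq, Real.sqrt_sq (by positivity)]
  field_simp

/-! ## The open logarithmic representation `[(1, σ), du/u]` and the chart move -/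

/-- `x ↦ 1/x₀` is `ℚ`-semialgebraic on the line over any `S ⊆ (0, ∞)`. -/
theorem isSemialgebraicFunOn_inv {S : Set ℝ} (hS : IsSemialgebraic ℚ (line S))
    (h0 : ∀ t ∈ S, 0 < t) : IsSemialgebraicFunOn ℚ (line S) (fun x : Fin 1 → ℝ => 1 / x 0) :=
  (isSemialgebraicFunOn_const_of_isAlgebraic hS isAlgebraic_one).div
    (isSemialgebraicFunOn_apply hS 0) fun _ hx => (h0 _ hx).ne'

/-- **`[(1, σ), du/u]`**, the logarithmic cell with its endpoints removed. -/
def openLog : IntegralRep 1 :=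
  lineRep (Ioo 1 silver) (fun t => 1 / t)
    (isSemialgebraic_line_Ioo isAlgebraic_one isAlgebraic_silver)
    (isSemialgebraicFunOn_inv (isSemialgebraic_line_Ioo isAlgebraic_one isAlgebraic_silver)
      fun _ ht => one_pos.trans ht.1)
    ((integrableOn_log_integrand 1 one_pos).mono_set Ioo_subset_Icc_self)

/-- **Move (`x = (u²-1)/(2u)`): `[(1, σ), du/u] ≡ H₁`.** -/
theorem openLog_sub_hyp1 : of openLog - of hyp1 ∈ relations := by
  unfold openLog hyp1
  exact lineRep_subst sinhChart sinhChart' isSemialgebraicFunOn_sinhChart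
    (fun t ht => (hasDerivAt_sinhChart (one_pos.trans ht.1)).hasDerivWithinAt) injOn_sinhChart
    image_sinhChart (fun t ht => sinhChart_pullback (one_pos.trans ht.1))

/-! ## Discarding the endpoints: `L(1; σ) ≡ [(1, σ), du/u]` -/

/-- The two endpoints `{1, σ}` as a (null) domain, with the same integrand. -/
def endsRep : IntegralRep 1 :=
  lineRep (Icc 1 1 ∪ Icc silver silver) (fun t => 1 / t)
    ((isSemialgebraic_line_Icc isAlgebraic_one isAlgebraic_one).union
      (isSemialgebraic_line_Icc isAlgebraic_silver isAlgebraic_silver))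
    (isSemialgebraicFunOn_inv ((isSemialgebraic_line_Icc isAlgebraic_one isAlgebraic_one).union
      (isSemialgebraic_line_Icc isAlgebraic_silver isAlgebraic_silver)) fun t ht => by
        rcases ht with ht | ht
        · exact one_pos.trans_le ht.1
        · exact silver_pos.trans_le ht.1)
    ((integrableOn_log_integrand 1 one_pos).mono_set (union_subset
      (Icc_subset_Icc le_rfl one_lt_silver.le) (Icc_subset_Icc one_lt_silver.le le_rfl)))

/-- The endpoint representation is a relation (its domain is null). -/
theorem endsRep_mem_relations : of endsRep ∈ relations :=
  of_mem_relations_of_volume_eq_zero _ (by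
    rw [endsRep, lineRep_domain, volume_line, Icc_self, Icc_self]
    exact ((Set.finite_singleton _).union (Set.finite_singleton _)).measure_zero _)

/-- `[1, σ] = (1, σ) ∪ {1, σ}`. -/
theorem Icc_eq_Ioo_union : Icc 1 silver = Ioo 1 silver ∪ (Icc 1 1 ∪ Icc silver silver) := by
  ext x
  simp only [mem_Icc, mem_Ioo, mem_union, Icc_self, mem_singleton_iff]
  constructor
  · rintro ⟨h1, h2⟩
    rcases h1.eq_or_lt with h | h
    · exact Or.inr (Or.inl h.symm)
    rcases h2.eq_or_lt with h' | h'
    · exact Or.inr (Or.inr h')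
    · exact Or.inl ⟨h, h'⟩
  · rintro (⟨h1, h2⟩ | rfl | rfl)
    · exact ⟨h1.le, h2.le⟩
    · exact ⟨le_rfl, one_lt_silver.le⟩
    · exact ⟨one_lt_silver.le, le_rfl⟩

/-- **Move (domain additivity): `L(1; σ) ≡ [(1, σ), du/u]`** (the endpoints are a null set). -/
theorem logCell_sub_openLog :
    of (logCell 1 silver isAlgebraic_one isAlgebraic_silver) - of openLog ∈ relations := by
  have h : of (logCell 1 silver isAlgebraic_one isAlgebraic_silver) - of openLog - of endsRep ∈
      relations := by
    refine domainAddRel_subset_relations ⟨1, logCell 1 silver isAlgebraic_one isAlgebraic_silver,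
      openLog, endsRep, ?_, ?_, fun _ _ => rfl, fun _ _ => rfl, rfl⟩
    · simp only [logCell_eq, logSeg_domain, openLog, endsRep, lineRep_domain, ← line_union,
        ← Icc_eq_Ioo_union]
    · simp only [openLog, endsRep, lineRep_domain, ← line_inter, volume_line]
      refine measure_mono_null inter_subset_right ?_
      rw [Icc_self, Icc_self]
      exact ((Set.finite_singleton _).union (Set.finite_singleton _)).measure_zero _
  simpa [sub_add_cancel] using relations.add_mem h endsRep_mem_relations

/-! ## The class of `Σ` and consequences -/

/-- **`[Σ] = ℓ(1+√2)`** in `Q`: three moves (Newton–Leibniz, the chart, the endpoints). -/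
theorem mkQ_hyp2 : mkQ (of hyp2) = ell silver := by
  rw [ell_eq isAlgebraic_silver, mkQ_eq_mkQ_iff]
  have h := relations.sub_mem (relations.sub_mem hyp2_sub_hyp1 openLog_sub_hyp1)
    logCell_sub_openLog
  convert h using 1
  abel

/-- `Σ` lies in the cell span `V`. -/
theorem mkQ_hyp2_mem_cellSpan : mkQ (of hyp2) ∈ cellSpan := by
  rw [mkQ_hyp2]
  exact ell_mem_cellSpan isAlgebraic_silver one_lt_silver

/-- **`area(Σ) = log (1 + √2)`**, read off from the moves. -/
theorem hyp2_value : hyp2.value = Real.log (1 + Real.sqrt 2) := by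
  have h := congrArg evalQ mkQ_hyp2
  rw [evalQ_mkQ, eval_of, evalQ_ell isAlgebraic_silver one_lt_silver.le] at h
  simpa [silver] using h

/-- `∫₀¹ dx/√(1+x²) = log (1 + √2)` (`= arsinh 1`), read off from the moves. -/
theorem hyp1_value : hyp1.value = Real.log (1 + Real.sqrt 2) := by
  rw [← hyp2_value]
  exact (Equivalent.value_eq_holds hyp2_sub_hyp1).symm

/-- **KZ on the cell span (Baker).** Two representations whose classes lie in `V` and whose
periods agree are equivalent under the Kontsevich–Zagier moves. -/
theorem kz_cellSpan {n m : ℕ} {r : IntegralRep n} {r' : IntegralRep m}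
    (hr : mkQ (of r) ∈ cellSpan) (hr' : mkQ (of r') ∈ cellSpan) (hv : r.value = r'.value) :
    Equivalent r r' := by
  rw [Equivalent, ← mkQ_eq_mkQ_iff, ← sub_eq_zero]
  exact eq_zero_of_mem_cellSpan (sub_mem hr hr')
    (by rw [map_sub, evalQ_mkQ, evalQ_mkQ, eval_of, eval_of, hv, sub_self])

/-- **The Kontsevich–Zagier conjecture for `Σ`**, unconditionally, against every representation
with class in `V` (all rational representations of dimension `≤ 1`, all cells, and `Σ` itself). -/
theorem kz_hyp2 {m : ℕ} (r' : IntegralRep m) (hr' : mkQ (of r') ∈ cellSpan)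
    (hv : hyp2.value = r'.value) : Equivalent hyp2 r' :=
  kz_cellSpan mkQ_hyp2_mem_cellSpan hr' hv

/-- In particular against every `ℚ`-rational representation of dimension `≤ 1`. -/
theorem kz_hyp2_rational {m : ℕ} (hm : m ≤ 1) (r' : IntegralRep m) (hr' : r'.IsRational)
    (hv : hyp2.value = r'.value) : Equivalent hyp2 r' :=
  kz_hyp2 r' (mkQ_of_mem_cellSpan r' hm hr') hv

/-- **`Σ ≡ L(1; 1+√2)`** by the three explicit moves. -/
theorem kz_hyp2_logCell :
    Equivalent hyp2 (logCell 1 silver isAlgebraic_one isAlgebraic_silver) := by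
  rw [Equivalent, ← mkQ_eq_mkQ_iff, mkQ_hyp2, ell_eq isAlgebraic_silver]

/-- **`Σ ≡ L(½; 3+2√2)`**: `∫∫_Σ 1` and `∫₁^{3+2√2} du/(2u)` are KZ-equivalent. -/
theorem kz_hyp2_logCell_sq :
    Equivalent hyp2 (logCell (((1:ℚ) / 2 : ℚ) : ℝ) (silver ^ 2) (isAlgebraic_rat ℚ _)
      (isAlgebraic_silver.pow 2)) := by
  have h1 : (1:ℝ) ≤ silver ^ 2 := by nlinarith [one_lt_silver]
  refine kz_hyp2 _ (mkQ_mem_cellSpan_of_isCellSum (isCellSum_logCell _ _ _ _ h1)) ?_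
  rw [hyp2_value, value_logCell h1, Real.log_pow, silver]
  push_cast
  ring

end SoloBlind

end Summit.KontsevichZagierPeriods.KontsevichZagierPeriods.Theorems
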